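import Summits.Parity.BatemanHorn.Theorems.AlmostPrimeZerosSystemLSDRealSegmentTruncatedLawCore
import HarnessLib

/-!
# `SystemLSDRealSegment` (stmt-Parity-11292), line `beta-thinned-root-kernel`: the `y`-tilted Kubilius model at
# height `x^θ` — the law of the TRUNCATED statistic, II: the crux's normalisation (lead c9)

For a Bateman–Horn system `f = (f₁,…,f_k)`, real `y ≥ 1` and a height `S`, the truncated capped statistic
`s_{f,S}(n) = Σᵢ Σ_{p<S} min(v_p(fᵢ(n)), 2)` counts only the prime factors `< S`.  Its `y`-moment is computable:

* `sum_truncStat_eq_add` — `Σ_{n≤x} y^{s_{f,S}(n)}` = (S-smooth divisor tuples of level `≤ x`) + (smooth part of the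
  kernel), via the truncated expansion `truncStat_expansion`;
* `mainTerm_tail_bounds` — `0 ≤ ∏_{p<S}E_p(y) − Σ_{m≤x, S-smooth} b(m) ≤ x^{−δ} ∏_{p<S} Σ_ν b(p^ν)(p^ν)^δ` (Rankin), with
  `E_p(y) = Σ_{ν≤2k} b(p^ν) ≥ 1` the real local factor of the crux's `λ_f`;
* `truncStat_ratio_law` — there is `C > 0` with, for every `θ ∈ (0,1]`, `ε > 0` and all large `x` (`S = ⌊x^θ⌋₊ + 1`):
  `|Σ_{n≤x} y^{s_{f,S}(n)} / ((x+1)∏_{p<S}E_p(y)) − 1| ≤ C e^{−1/θ} + ε`;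
* `truncStat_law_normalised` — in the crux's normalisation:
  `|Σ_{n≤x} y^{s_{f,⌊x^θ⌋₊+1}(n)} /(x (log x)^{k(y−1)}) − Re λ_f(y)·e^{γk(y−1)}·θ^{k(y−1)}| ≤ C e^{−1/θ} + ε` eventually.

Compare the crux: the SAME normalised sum with the full statistic `s_f` is conjectured to tend to
`λ_f(y)·D^{y−1}Γ(y)^{−k}`; unconditionally, at every fixed height `x^θ` the `y`-tilted model is the finite Euler product
of its local factors up to `O(e^{−1/θ})`, with the Mertens factor `(e^γ θ)^{k(y−1)}` in place of `D^{y−1}Γ(y)^{−k}` — the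
difference is exactly the (open) law of the prime factors `> x^θ` (the rough-kernel stubs of the skeleton).
Inputs: `smoothTypeI_sandwich`, `smoothSupport_eulerProduct`, `twistedLocalProduct_le`, `eulerProduct_primesLE_asymp`,
`smoothKernel_le` (all landed), Levin–Faĭnleĭb for `b` (`exists_eulerFactor_ofReal`).  Everything is PROVED; no definitions.
-/

open Filter Finset Polynomial
open scoped BigOperators Topology

namespace Summit.Parity.BatemanHorn.Cruxes.SystemLSDRealSegment.BetaThinnedRootKernel

open Literature.NumberTheory.Sieve

noncomputable section

section Law

variable {k : ℕ} {f : Fin k → ℤ[X]}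

/-! ### The law in the crux's normalisation -/

/-- `log ⌊x^θ⌋₊ / log x → θ` along `x → ∞` (`θ > 0`). [folklore] -/
theorem tendsto_log_floor_rpow_div_log {θ : ℝ} (hθ : 0 < θ) :
    Tendsto (fun x : ℕ => Real.log (⌊(x : ℝ) ^ θ⌋₊ : ℕ) / Real.log x) atTop (𝓝 θ) := by
  have hxθ : Tendsto (fun x : ℕ => (x : ℝ) ^ θ) atTop atTop :=
    (tendsto_rpow_atTop hθ).comp tendsto_natCast_atTop_atTop
  have hlog : Tendsto (fun x : ℕ => Real.log (x : ℝ)) atTop atTop :=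
    Real.tendsto_log_atTop.comp tendsto_natCast_atTop_atTop
  -- lower bound `θ − log 2 / log x`, upper bound `θ`
  have hlow : Tendsto (fun x : ℕ => θ - Real.log 2 / Real.log x) atTop (𝓝 θ) := by
    have h : Tendsto (fun x : ℕ => Real.log 2 / Real.log (x : ℝ)) atTop (𝓝 0) :=
      tendsto_const_nhds.div_atTop hlog
    have h2 : Tendsto (fun x : ℕ => θ - Real.log 2 / Real.log (x : ℝ)) atTop (𝓝 (θ - 0)) :=
      tendsto_const_nhds.sub h
    rwa [sub_zero] at h2
  refine tendsto_of_tendsto_of_tendsto_of_le_of_le' hlow tendsto_const_nhds ?_ ?_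
  · filter_upwards [hxθ.eventually_ge_atTop 2, eventually_ge_atTop 2] with x hx hx2
    have hx2' : (2 : ℝ) ≤ x := by exact_mod_cast hx2
    have hx0 : (0 : ℝ) < x := by linarith
    have hlogx : 0 < Real.log x := Real.log_pos (by linarith)
    have hN : (x : ℝ) ^ θ / 2 ≤ (⌊(x : ℝ) ^ θ⌋₊ : ℕ) := by
      have := Nat.lt_floor_add_one ((x : ℝ) ^ θ)
      linarith
    have hNpos : (0 : ℝ) < (⌊(x : ℝ) ^ θ⌋₊ : ℕ) := lt_of_lt_of_le (by linarith) hN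
    have key : θ * Real.log x - Real.log 2 ≤ Real.log (⌊(x : ℝ) ^ θ⌋₊ : ℕ) := by
      calc θ * Real.log x - Real.log 2 = Real.log ((x : ℝ) ^ θ / 2) := by
            rw [Real.log_div (by positivity) (by norm_num), Real.log_rpow hx0]
        _ ≤ Real.log (⌊(x : ℝ) ^ θ⌋₊ : ℕ) := Real.log_le_log (by positivity) hN
    rw [sub_le_iff_le_add, ← add_div, le_div_iff₀ hlogx]
    linarith
  · filter_upwards [hxθ.eventually_ge_atTop 1, eventually_ge_atTop 2] with x hx hx2
    have hx2' : (2 : ℝ) ≤ x := by exact_mod_cast hx2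
    have hx0 : (0 : ℝ) < x := by linarith
    have hlogx : 0 < Real.log x := Real.log_pos (by linarith)
    have hN : ((⌊(x : ℝ) ^ θ⌋₊ : ℕ) : ℝ) ≤ (x : ℝ) ^ θ := Nat.floor_le (by positivity)
    have hN1 : (1 : ℝ) ≤ (⌊(x : ℝ) ^ θ⌋₊ : ℕ) := by exact_mod_cast Nat.le_floor (by exact_mod_cast hx)
    rw [div_le_iff₀ hlogx]
    calc Real.log (⌊(x : ℝ) ^ θ⌋₊ : ℕ) ≤ Real.log ((x : ℝ) ^ θ) := Real.log_le_log (by linarith) hN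
      _ = θ * Real.log x := Real.log_rpow hx0 θ

/-- **The `y`-tilted Kubilius model at height `x^θ`, in the crux's normalisation.**  For a Bateman–Horn system
`f` and real `y ≥ 1` there is `C > 0` such that for every `θ ∈ (0, 1]`, every `ε > 0` and all large `x`,
`|Σ_{0≤n≤x} y^{s_{f,⌊x^θ⌋₊+1}(n)} / (x (log x)^{k(y−1)}) − Re λ_f(y) · e^{γ k(y−1)} · θ^{k(y−1)}| ≤ C e^{−1/θ} + ε`.
Compare the crux `SystemLSDRealSegment`: the SAME normalised sum with the full statistic `s_f` is conjectured to tend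
to `λ_f(y) · D^{y−1} Γ(y)^{−k}` — the factor `(e^γ θ)^{k(y−1)}` of the primes `≤ x^θ` being replaced by the
contribution `D^{y−1}Γ(y)^{−k}` of all prime factors; the difference is exactly the (open) law of the prime factors
`> x^θ`. [folklore] -/
theorem truncStat_law_normalised (hf : IsBatemanHornSystem f) {y : ℝ} (hy : 1 ≤ y) :
    ∃ C : ℝ, 0 < C ∧ ∀ θ : ℝ, 0 < θ → θ ≤ 1 → ∀ ε : ℝ, 0 < ε → ∀ᶠ x : ℕ in atTop,
      |(∑ n ∈ range (x + 1), y ^ (∑ i, (((f i).eval (n : ℤ)).toNat.factorization.sum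
            fun p v => if p < ⌊(x : ℝ) ^ θ⌋₊ + 1 then min v 2 else 0))) / ((x : ℝ) * Real.log x ^ ((k : ℝ) * (y - 1))) -
        (eulerFactor f (y : ℂ)).re * Real.exp (Real.eulerMascheroniConstant * ((k : ℝ) * (y - 1))) *
          θ ^ ((k : ℝ) * (y - 1))| ≤ C * Real.exp (-1 / θ) + ε := by
  set κ : ℝ := (k : ℝ) * (y - 1) with hκ
  have hκ0 : 0 ≤ κ := mul_nonneg (Nat.cast_nonneg _) (by linarith)
  set Λ₀ : ℝ := (eulerFactor f (y : ℂ)).re * Real.exp (Real.eulerMascheroniConstant * κ) with hΛ₀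
  have hΛ₀pos : 0 < Λ₀ := mul_pos (eulerFactor_re_pos hf hy) (Real.exp_pos _)
  obtain ⟨C, hC, hlaw⟩ := truncStat_ratio_law hf hy
  have hT5 := eulerProduct_primesLE_asymp k f hf y hy
  refine ⟨C * Λ₀, by positivity, fun θ hθ hθ1 ε hε => ?_⟩
  -- `ε'`
  set ε' : ℝ := min 1 (ε / (C + Λ₀ + 2)) with hε'
  have hε'pos : 0 < ε' := lt_min one_pos (by positivity)
  have hε'1 : ε' ≤ 1 := min_le_left _ _
  have hε'ε : ε' * (C + Λ₀ + 2) ≤ ε := by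
    have : ε' ≤ ε / (C + Λ₀ + 2) := min_le_right _ _
    rwa [le_div_iff₀ (by positivity)] at this
  -- the normalising quotient `Q_x = (x+1) E_N / (x (log x)^κ) → Λ₀ θ^κ`
  have hxθ : Tendsto (fun x : ℕ => (x : ℝ) ^ θ) atTop atTop :=
    (tendsto_rpow_atTop hθ).comp tendsto_natCast_atTop_atTop
  have hN : Tendsto (fun x : ℕ => ⌊(x : ℝ) ^ θ⌋₊) atTop atTop := tendsto_nat_floor_atTop.comp hxθ
  have hE := hT5.comp hN
  have hratio : Tendsto (fun x : ℕ => (Real.log (⌊(x : ℝ) ^ θ⌋₊ : ℕ) / Real.log x) ^ κ) atTop (𝓝 (θ ^ κ)) :=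
    (tendsto_log_floor_rpow_div_log hθ).rpow_const (Or.inr hκ0)
  have hx1 : Tendsto (fun x : ℕ => ((x : ℝ) + 1) / x) atTop (𝓝 1) := by
    have h : Tendsto (fun n : ℕ => 1 / (n : ℝ)) atTop (𝓝 0) := tendsto_one_div_atTop_nhds_zero_nat
    have h2 : Tendsto (fun x : ℕ => 1 + 1 / (x : ℝ)) atTop (𝓝 (1 + 0)) := tendsto_const_nhds.add h
    rw [add_zero] at h2
    refine h2.congr' ?_
    filter_upwards [eventually_ge_atTop 1] with x hx
    have hx0 : (x : ℝ) ≠ 0 := by exact_mod_cast (show x ≠ 0 by omega)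
    field_simp
  have hQ : Tendsto (fun x : ℕ => ((x : ℝ) + 1) / x *
      ((∏ p ∈ Nat.primesLE ⌊(x : ℝ) ^ θ⌋₊, ∑ ν ∈ range (2 * k + 1), bCoeff f y (p ^ ν)) /
        Real.log (⌊(x : ℝ) ^ θ⌋₊ : ℕ) ^ κ) *
      (Real.log (⌊(x : ℝ) ^ θ⌋₊ : ℕ) / Real.log x) ^ κ) atTop (𝓝 (1 * Λ₀ * θ ^ κ)) :=
    (hx1.mul hE).mul hratio
  rw [one_mul] at hQ
  have hQev := Metric.tendsto_nhds.1 hQ ε' hε'pos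
  filter_upwards [hlaw θ hθ hθ1 ε' hε'pos, hQev, eventually_ge_atTop 2, hxθ.eventually_ge_atTop 2] with x hxl hxQ hx2 hxθ2
  have hx2' : (2 : ℝ) ≤ x := by exact_mod_cast hx2
  have hx0 : (0 : ℝ) < x := by linarith
  have hlogx : 0 < Real.log x := Real.log_pos (by linarith)
  set N : ℕ := ⌊(x : ℝ) ^ θ⌋₊ with hNdef
  have hN2 : 2 ≤ N := Nat.le_floor (by exact_mod_cast hxθ2)
  have hN2r : (2 : ℝ) ≤ N := by exact_mod_cast hN2
  have hlogN : 0 < Real.log N := Real.log_pos (by linarith)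
  set E : ℝ := ∏ p ∈ Nat.primesBelow (N + 1), ∑ ν ∈ range (2 * k + 1), bCoeff f y (p ^ ν) with hEdef
  have hEN : E = ∏ p ∈ Nat.primesLE N, ∑ ν ∈ range (2 * k + 1), bCoeff f y (p ^ ν) := by
    rw [hEdef, Nat.primesLE]
  have hEpos : 0 < E := by
    rw [hEdef]
    exact lt_of_lt_of_le zero_lt_one (one_le_prod_localSum hf hy _)
  set T : ℝ := ∑ n ∈ range (x + 1), y ^ (∑ i, (((f i).eval (n : ℤ)).toNat.factorization.sum
      fun p v => if p < N + 1 then min v 2 else 0)) with hTdef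
  set Q : ℝ := ((x : ℝ) + 1) / x * (E / Real.log N ^ κ) * (Real.log N / Real.log x) ^ κ with hQdef
  -- `Q = (x+1) E / (x (log x)^κ)`
  have hQeq : Q = ((x : ℝ) + 1) * E / ((x : ℝ) * Real.log x ^ κ) := by
    rw [hQdef, Real.div_rpow hlogN.le hlogx.le]
    field_simp
  have hQdist : |Q - Λ₀ * θ ^ κ| < ε' := by
    have := hxQ
    rw [Real.dist_eq, ← hEN] at this
    exact this
  have hQpos : 0 < Q := by rw [hQeq]; positivity
  have hρ : |T / (((x : ℝ) + 1) * E) - 1| ≤ C * Real.exp (-1 / θ) + ε' := hxl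
  -- `T/(x (log x)^κ) = (T/((x+1)E)) · Q`
  have hTQ : T / ((x : ℝ) * Real.log x ^ κ) = T / (((x : ℝ) + 1) * E) * Q := by
    rw [hQeq]; field_simp
  rw [hTQ]
  have hθκ : θ ^ κ ≤ 1 := Real.rpow_le_one hθ.le hθ1 hκ0
  have hQle : Q ≤ Λ₀ + ε' := by
    have := (abs_lt.1 hQdist).2
    nlinarith [mul_le_mul_of_nonneg_left hθκ hΛ₀pos.le]
  have hexp1 : Real.exp (-1 / θ) ≤ 1 := by
    rw [Real.exp_le_one_iff (x := -1 / θ)]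
    exact div_nonpos_of_nonpos_of_nonneg (by norm_num) hθ.le
  calc |T / (((x : ℝ) + 1) * E) * Q - Λ₀ * θ ^ κ|
      = |(T / (((x : ℝ) + 1) * E) - 1) * Q + (Q - Λ₀ * θ ^ κ)| := by ring_nf
    _ ≤ |(T / (((x : ℝ) + 1) * E) - 1) * Q| + |Q - Λ₀ * θ ^ κ| := abs_add_le _ _
    _ = |T / (((x : ℝ) + 1) * E) - 1| * Q + |Q - Λ₀ * θ ^ κ| := by rw [abs_mul, abs_of_pos hQpos]
    _ ≤ (C * Real.exp (-1 / θ) + ε') * (Λ₀ + ε') + ε' := by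
        gcongr
    _ = C * Λ₀ * Real.exp (-1 / θ) + ε' * (C * Real.exp (-1 / θ) + Λ₀ + ε' + 1) := by ring
    _ ≤ C * Λ₀ * Real.exp (-1 / θ) + ε' * (C + Λ₀ + 2) := by
        have h1 : C * Real.exp (-1 / θ) ≤ C := by nlinarith [mul_le_mul_of_nonneg_left hexp1 hC.le]
        have h2 : ε' * (C * Real.exp (-1 / θ) + Λ₀ + ε' + 1) ≤ ε' * (C + Λ₀ + 2) :=
          mul_le_mul_of_nonneg_left (by linarith) hε'pos.le
        linarith
    _ ≤ C * Λ₀ * Real.exp (-1 / θ) + ε := by linarith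

end Law

/-! ### Registered closed form -/

/-- **truncStatLawNormalised** (registered closed form, `--supports stmt-Parity-11292`): the `y`-tilted Kubilius model
at height `x^θ` in the crux's normalisation, constant `Re λ_f(y) e^{γk(y−1)} θ^{k(y−1)}`. [folklore] -/
theorem truncStatLawNormalised : ∀ (k : ℕ) (f : Fin k → ℤ[X]), IsBatemanHornSystem f → ∀ y : ℝ, 1 ≤ y → ∃ C : ℝ, 0 < C ∧ ∀ θ : ℝ, 0 < θ → θ ≤ 1 → ∀ ε : ℝ, 0 < ε → ∀ᶠ x : ℕ in atTop, |(∑ n ∈ Finset.range (x + 1), y ^ (∑ i, (((f i).eval (n : ℤ)).toNat.factorization.sum fun p v => if p < ⌊(x : ℝ) ^ θ⌋₊ + 1 then min v 2 else 0))) / ((x : ℝ) * Real.log x ^ ((k : ℝ) * (y - 1))) - (eulerFactor f (y : ℂ)).re * Real.exp (Real.eulerMascheroniConstant * ((k : ℝ) * (y - 1))) * θ ^ ((k : ℝ) * (y - 1))| ≤ C * Real.exp (-1 / θ) + ε :=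
  fun _k _f hf _y hy => truncStat_law_normalised hf hy

end

end Summit.Parity.BatemanHorn.Cruxes.SystemLSDRealSegment.BetaThinnedRootKernel
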